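import Literature.AlgebraicGeometry.Resolution.AffineBlowupUniversal
import Literature.AlgebraicGeometry.Resolution.BlowupsIntegral
import Literature.AlgebraicGeometry.Resolution.BlowupsLocal
import Literature.AlgebraicGeometry.Resolution.MarkedIdealsLemmas
import Literature.AlgebraicGeometry.Resolution.IdealSheafLemmas
import HarnessLib

/-!
# Isomorphic fractional ideals have the same blowing up

Topic: `Literature/AlgebraicGeometry/Resolution`. For a domain `R`, nonzero `a ∈ R` and a
nonzero ideal `I ⊆ R`, a morphism `π : W → Spec R` is a blowing up along `Ĩ` if and only if it
is a blowing up along `(aI)~` (universal property `IsBlowup` of Görtz–Wedhorn Def. 13.90,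
`Blowups.lean`); hence two ideals `I, J` with `f J = g I` (`f, g ≠ 0`), i.e. isomorphic as
fractional ideals, have the same blowing ups. This is the remark "isomorphic fractionary ideals
define the same blow-up" on which the blow-up of a ring at a module rests (O. Villamayor U.,
J. Algebra 295 (2006), proof of Thm. 3.3 and 3.4); it is the patching input for F-blowups
(`FBlowup.lean`). All PROVED:

* `affineBlowup.idealSheaf_ne_bot`, `affineBlowup.idealSheaf_mul` — `Ĩ ≠ ⊥` for `I ≠ ⊥`,
  `(IJ)~ = Ĩ J̃`;
* `sectionsMap π V : R →+* Γ(W, V)` and `ideal_comap_idealSheaf` — the chart formula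
  `(π⁻¹ Ĩ)(V) = I · Γ(W, V)` (from the tree's `ideal_comap_of_le`);
* `Ideal.exists_generator_of_span_singleton_mul_eq` — if `(α) J = (v)` with `v` regular then
  `α` is regular and `J = (w)` with `w` regular;
* `IsBlowup.sectionsMap_mem_nonZeroDivisors` — on a blowing up `W` of `Spec R` along `Ĩ`
  (`R` a domain, `I ≠ 0`) nonzero elements of `R` stay regular in every `Γ(W, V)` (`W` is
  integral and `π` is an isomorphism over the dense open `Spec R ∖ V(I)`);
* `IsBlowup.span_singleton_mul`, `IsBlowup.of_span_singleton_mul`,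
  `isBlowup_span_singleton_mul_iff` — **`IsBlowup π Ĩ ↔ IsBlowup π (aI)~`**;
* `isBlowup_iff_of_span_singleton_mul_eq` — **`f J = g I` ⇒ (`IsBlowup π Ĩ ↔ IsBlowup π J̃`)**.

## Sources

* O. Villamayor U., *On flattening of coherent sheaves and of projective morphisms*,
  J. Algebra 295 (2006) 119–140, (2.0.1) and proof of Thm. 3.3 ("isomorphic fractionary ideals
  define the same blow-up"), 3.4. [Villamayoru2006]
* U. Görtz, T. Wedhorn, *Algebraic Geometry I*, 2nd ed., Def. 13.90. [GortzWedhorn2020]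
-/

noncomputable section

open CategoryTheory CategoryTheory.Limits AlgebraicGeometry TopologicalSpace

namespace Literature.AlgebraicGeometry.Resolution

universe u

variable {R : Type u} [CommRing R]

/-! ## Ideal sheaves of ideals on `Spec R` -/

/-- The ideal sheaf `Ĩ` on `Spec R` of a nonzero ideal `I ⊆ R` is nonzero. [folklore] -/
theorem affineBlowup.idealSheaf_ne_bot {I : Ideal R} (hI : I ≠ ⊥) :
    affineBlowup.idealSheaf I ≠ ⊥ := by
  intro h
  apply hI
  have h1 := congrArg (fun J : (Spec (.of R)).IdealSheafData => J.ideal ⟨⊤, isAffineOpen_top _⟩) h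
  simp only [affineBlowup.idealSheaf, ideal_ofIdealTop_top,
    Scheme.IdealSheafData.ideal_bot, Pi.bot_apply] at h1
  exact (Ideal.map_eq_bot_iff_of_injective
    (Scheme.ΓSpecIso (.of R)).symm.commRingCatIsoToRingEquiv.injective).mp h1

/-- The ideal sheaf of a product of ideals is the product of the ideal sheaves. [folklore] -/
theorem affineBlowup.idealSheaf_mul (I J : Ideal R) :
    affineBlowup.idealSheaf (I * J) = affineBlowup.idealSheaf I * affineBlowup.idealSheaf J := by
  apply Scheme.IdealSheafData.ext_of_isAffine
  rw [Scheme.IdealSheafData.ideal_mul, Pi.mul_apply]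
  simp only [affineBlowup.idealSheaf, ideal_ofIdealTop_top, Ideal.map_mul]

/-! ## The chart formula for the inverse image of `Ĩ` -/

section Chart

variable {T : Scheme.{u}} (f : T ⟶ Spec (.of R)) (V : T.affineOpens)

/-- The ring map `R → Γ(T, V)` induced by `f : T → Spec R` on an affine open `V ⊆ T`.
[folklore] -/
def sectionsMap : R →+* Γ(T, V) :=
  (f.appLE ⊤ V le_top).hom.comp (Scheme.ΓSpecIso (.of R)).inv.hom

/-- **Chart formula**: the ideal of the inverse image ideal sheaf `π⁻¹Ĩ · 𝒪_T` on an affine open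
`V` is the extension `I · Γ(T, V)` of `I` along `sectionsMap f V`. [folklore] -/
theorem ideal_comap_idealSheaf (I : Ideal R) :
    ((affineBlowup.idealSheaf I).comap f).ideal V = I.map (sectionsMap f V) := by
  rw [ideal_comap_of_le f _ ⟨⊤, isAffineOpen_top _⟩ V le_top, affineBlowup.idealSheaf,
    ideal_ofIdealTop_top, Ideal.map_map]
  rfl

/-- Restricting `sectionsMap` to a smaller affine open. [folklore] -/
theorem map_sectionsMap {V' : T.affineOpens} (h : (V' : T.Opens) ≤ V) (r : R) :
    T.presheaf.map (homOfLE h).op (sectionsMap f V r) = sectionsMap f V' r := by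
  change (f.appLE ⊤ V le_top ≫ T.presheaf.map (homOfLE h).op) ((Scheme.ΓSpecIso (.of R)).inv r) = _
  rw [Scheme.Hom.appLE_map]
  rfl

end Chart

/-! ## A ring lemma: principal multiples of an ideal -/

/-- If `(α) · J = (v)` with `v` a nonzerodivisor, then `α` is a nonzerodivisor and `J = (w)` for a
nonzerodivisor `w ∈ J` (indeed `v = α w`). [folklore] -/
theorem Ideal.exists_generator_of_span_singleton_mul_eq {B : Type*} [CommRing B] {α v : B}
    {J : Ideal B} (hv : v ∈ nonZeroDivisors B) (h : Ideal.span {α} * J = Ideal.span {v}) :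
    α ∈ nonZeroDivisors B ∧ ∃ w ∈ J, w ∈ nonZeroDivisors B ∧ J = Ideal.span {w} := by
  have hv' : v ∈ Ideal.span {α} * J := h ▸ Ideal.mem_span_singleton_self v
  obtain ⟨w, hwJ, hvw⟩ := Ideal.mem_span_singleton_mul.mp hv'
  have hα : α ∈ nonZeroDivisors B := by
    rw [mem_nonZeroDivisors_iff_right]
    intro z hz
    apply (mem_nonZeroDivisors_iff_right.mp hv) z
    rw [← hvw, ← mul_assoc, hz, zero_mul]
  have hw : w ∈ nonZeroDivisors B := by
    rw [mem_nonZeroDivisors_iff_right]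
    intro z hz
    apply (mem_nonZeroDivisors_iff_right.mp hv) z
    rw [← hvw, mul_left_comm, hz, mul_zero]
  refine ⟨hα, w, hwJ, hw, le_antisymm ?_ ((Ideal.span_singleton_le_iff_mem _).mpr hwJ)⟩
  intro j hj
  have hαj : α * j ∈ Ideal.span {v} := h ▸ Ideal.mul_mem_mul (Ideal.mem_span_singleton_self α) hj
  obtain ⟨c, hc⟩ := Ideal.mem_span_singleton'.mp hαj
  -- `α j = c v = c α w`, so `j = c w`
  have h1 : (j - c * w) * α = 0 := by
    have h2 : α * j = c * (α * w) := by rw [hvw]; exact hc.symm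
    linear_combination h2
  have h3 : j - c * w = 0 := (mem_nonZeroDivisors_iff_right.mp hα) _ h1
  rw [sub_eq_zero] at h3
  rw [h3]
  exact Ideal.mul_mem_left _ c (Ideal.mem_span_singleton_self w)

/-! ## Nonzero elements of `R` stay regular on a blowing up of `Spec R` -/

section Regular

variable [IsDomain R] {W : Scheme.{u}} {π : W ⟶ Spec (.of R)} {I : Ideal R}

/-- **On a blowing up `π : W → Spec R` along `Ĩ` (`R` a domain, `I ≠ 0`), a nonzero `a ∈ R` is a
nonzerodivisor in every `Γ(W, V)`**: `W` is integral (Stacks 02ND), so for nonempty `V` it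
suffices that `a ≠ 0` in the domain `Γ(W, V)`; but `π` is an isomorphism over the dense open
`U₀ = Spec R ∖ V(I)` (Stacks 02OS), so `π⁻¹(D(a))` is a nonempty open of the irreducible `W` and
meets `V`, and on `V ∩ π⁻¹(D(a))` the section `a` is a unit, hence not zero. [folklore] -/
theorem IsBlowup.sectionsMap_mem_nonZeroDivisors (hI : I ≠ ⊥)
    (h : IsBlowup π (affineBlowup.idealSheaf I)) {a : R} (ha : a ≠ 0) (V : W.affineOpens) :
    sectionsMap π V a ∈ nonZeroDivisors Γ(W, V) := by
  have hJ : affineBlowup.idealSheaf I ≠ ⊥ := affineBlowup.idealSheaf_ne_bot hI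
  haveI : IsIntegral W := h.isIntegral hJ
  rcases ((V : W.Opens) : Set W).eq_empty_or_nonempty with hV | hV
  · -- `V = ∅`: the zero ring
    have : (V : W.Opens) = ⊥ := SetLike.ext' hV
    haveI : Subsingleton Γ(W, V) :=
      CommRingCat.subsingleton_of_isTerminal (W.sheaf.isTerminalOfEqEmpty this)
    exact mem_nonZeroDivisors_iff_right.mpr fun z _ => Subsingleton.elim _ _
  haveI : Nonempty (V : W.Opens) := by
    obtain ⟨v, hv⟩ := hV
    exact ⟨⟨v, hv⟩⟩
  refine mem_nonZeroDivisors_of_ne_zero fun h0 => ?_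
  -- the element `a` as a global section of `Spec R`, its basic open `D(a)`
  let a' : Γ(Spec (.of R), ⊤) := (Scheme.ΓSpecIso (.of R)).inv a
  have hD : (((Spec (.of R)).basicOpen a' : (Spec (.of R)).Opens) : Set (Spec (.of R))).Nonempty := by
    refine ⟨⟨⊥, Ideal.isPrime_bot⟩, ?_⟩
    change (⟨⊥, Ideal.isPrime_bot⟩ : PrimeSpectrum R) ∈ (Spec (CommRingCat.of R)).basicOpen a'
    rw [basicOpen_eq_of_affine]
    change a ∉ (⊥ : Ideal R)
    simpa using ha
  -- a point `s ∈ U₀ ∩ D(a)` and a point `x` of `W` over it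
  obtain ⟨s, hsU, hsD⟩ := nonempty_preirreducible_inter (centreCompl (affineBlowup.idealSheaf I)).2
    ((Spec (.of R)).basicOpen a').2 (centreCompl_nonempty hJ) hD
  haveI : IsIso (π ∣_ centreCompl (affineBlowup.idealSheaf I)) := h.isIso_compl
  let x := (asIso (π ∣_ centreCompl (affineBlowup.idealSheaf I))).inv ⟨s, hsU⟩
  have hx : (π ∣_ centreCompl (affineBlowup.idealSheaf I)) x = ⟨s, hsU⟩ := by
    change ((asIso (π ∣_ centreCompl (affineBlowup.idealSheaf I))).inv ≫
      (asIso (π ∣_ centreCompl (affineBlowup.idealSheaf I))).hom) ⟨s, hsU⟩ = _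
    rw [Iso.inv_hom_id]
    rfl
  have hπx : π x.1 = s := by
    rw [← morphismRestrict_base_coe, hx]
  have hxO : x.1 ∈ π ⁻¹ᵁ (Spec (.of R)).basicOpen a' := by
    change π x.1 ∈ (Spec (.of R)).basicOpen a'
    rw [hπx]
    exact hsD
  -- `V` meets `O = π⁻¹(D(a))`
  obtain ⟨t, htV, htO⟩ := nonempty_preirreducible_inter (V : W.Opens).2
    (π ⁻¹ᵁ (Spec (.of R)).basicOpen a').2 hV ⟨x.1, hxO⟩
  let VO : W.Opens := (V : W.Opens) ⊓ π ⁻¹ᵁ (Spec (.of R)).basicOpen a'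
  haveI : Nonempty VO := ⟨⟨t, htV, htO⟩⟩
  -- on `V ∩ O` the section `a` is a unit …
  have hunit : IsUnit (W.presheaf.map (homOfLE (inf_le_left : VO ≤ V)).op (sectionsMap π V a)) := by
    have e1 : W.presheaf.map (homOfLE (inf_le_left : VO ≤ V)).op (sectionsMap π V a) =
        π.appLE ((Spec (.of R)).basicOpen a') VO inf_le_right
          ((Spec (.of R)).presheaf.map (homOfLE ((Spec (.of R)).basicOpen_le a')).op a') := by
      change (π.appLE ⊤ V le_top ≫ W.presheaf.map (homOfLE _).op) a' =
        ((Spec (.of R)).presheaf.map (homOfLE _).op ≫ π.appLE _ VO inf_le_right) a'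
      rw [Scheme.Hom.appLE_map, Scheme.Hom.map_appLE]
    rw [e1]
    exact ((Spec (.of R)).toRingedSpace.isUnit_res_basicOpen a').map _
  -- … and zero: contradiction in the nontrivial ring `Γ(W, V ∩ O)`
  have hzero : W.presheaf.map (homOfLE (inf_le_left : VO ≤ V)).op (sectionsMap π V a) = 0 := by
    rw [h0, map_zero]
  rw [hzero] at hunit
  exact not_isUnit_zero hunit

end Regular

/-! ## Scaling the centre by a principal ideal -/

section Scaling

variable [IsDomain R] {W : Scheme.{u}} {π : W ⟶ Spec (.of R)} {I : Ideal R}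

omit [IsDomain R] in
/-- The inverse image of `Ĩ` is effective Cartier as soon as the inverse image of `(aI)~` is
(any scheme `T → Spec R`, any `a`): on a chart `(α)(I Γ) = (v)` forces `I Γ = (w)` with `w`
regular (`Ideal.exists_generator_of_span_singleton_mul_eq`). [folklore] -/
theorem isEffectiveCartier_comap_of_span_singleton_mul {T : Scheme.{u}} (f : T ⟶ Spec (.of R))
    (a : R) (hf : IsEffectiveCartier ((affineBlowup.idealSheaf (Ideal.span {a} * I)).comap f)) :
    IsEffectiveCartier ((affineBlowup.idealSheaf I).comap f) := by
  intro x
  obtain ⟨V, hxV, v, hv, hV⟩ := hf x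
  rw [ideal_comap_idealSheaf, Ideal.map_mul, Ideal.map_span, Set.image_singleton] at hV
  obtain ⟨-, w, -, hw, hJw⟩ := Ideal.exists_generator_of_span_singleton_mul_eq hv hV
  refine ⟨V, hxV, w, hw, ?_⟩
  rw [ideal_comap_idealSheaf, hJw]

/-- **Scaling up**: a blowing up of `Spec R` along `Ĩ` (`R` a domain, `I ≠ 0`) is a blowing up
along `(aI)~` for every nonzero `a ∈ R`. The exceptional ideal `(aI) 𝒪_W = a · (I 𝒪_W)` is
generated on each Cartier chart by `a u`, regular because `a` stays regular on `W`
(`IsBlowup.sectionsMap_mem_nonZeroDivisors`); a test morphism making `(aI)~` effective Cartier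
makes `Ĩ` effective Cartier, so it factors uniquely. [cite: Villamayoru2006, proof of Thm. 3.3] -/
theorem IsBlowup.span_singleton_mul (hI : I ≠ ⊥) (h : IsBlowup π (affineBlowup.idealSheaf I))
    {a : R} (ha : a ≠ 0) : IsBlowup π (affineBlowup.idealSheaf (Ideal.span {a} * I)) := by
  constructor
  · intro x
    obtain ⟨V, hxV, u, hu, hV⟩ := h.isEffectiveCartier x
    refine ⟨V, hxV, sectionsMap π V a * u, mul_mem (h.sectionsMap_mem_nonZeroDivisors hI ha V) hu,
      ?_⟩
    rw [ideal_comap_idealSheaf] at hV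
    rw [ideal_comap_idealSheaf, Ideal.map_mul, hV, Ideal.map_span, Set.image_singleton,
      Ideal.span_singleton_mul_span_singleton]
  · intro T f hf
    exact h.universal f (isEffectiveCartier_comap_of_span_singleton_mul f a hf)

/-- **Scaling down**: a blowing up along `(aI)~` is a blowing up along `Ĩ` (`R` a domain,
`I ≠ 0`, `a ≠ 0`): the affine blowing up `Bl_I(Spec R)` is a blowing up along `Ĩ`
(`affineBlowup.isBlowup`) hence along `(aI)~` (scaling up), so it is isomorphic over `Spec R` to
`π`, and being a blowing up along `Ĩ` transports along the isomorphism.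
[cite: Villamayoru2006, proof of Thm. 3.3] -/
theorem IsBlowup.of_span_singleton_mul (hI : I ≠ ⊥) {a : R} (ha : a ≠ 0)
    (h : IsBlowup π (affineBlowup.idealSheaf (Ideal.span {a} * I))) :
    IsBlowup π (affineBlowup.idealSheaf I) := by
  have h₀ : IsBlowup (affineBlowup.π I) (affineBlowup.idealSheaf I) := affineBlowup.isBlowup I
  have h₀' := h₀.span_singleton_mul hI ha
  obtain ⟨e, he, -⟩ := h.unique h₀'
  have := h₀.iso_comp e
  rwa [he] at this

/-- **`IsBlowup π Ĩ ↔ IsBlowup π (aI)~`** for `R` a domain, `I ≠ 0`, `a ≠ 0`.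
[cite: Villamayoru2006, proof of Thm. 3.3] -/
theorem isBlowup_span_singleton_mul_iff (hI : I ≠ ⊥) {a : R} (ha : a ≠ 0) :
    IsBlowup π (affineBlowup.idealSheaf (Ideal.span {a} * I)) ↔
      IsBlowup π (affineBlowup.idealSheaf I) :=
  ⟨IsBlowup.of_span_singleton_mul hI ha, fun h => h.span_singleton_mul hI ha⟩

/-- **Isomorphic fractional ideals have the same blowing ups**: if `f J = g I` for nonzero
`f, g ∈ R` (`R` a domain, `I ≠ 0`), then `π` is a blowing up of `Spec R` along `Ĩ` iff it is
one along `J̃` (Villamayor: "isomorphic fractionary ideals define the same blow-up").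
[cite: Villamayoru2006, (2.0.1) and proof of Thm. 3.3] -/
theorem isBlowup_iff_of_span_singleton_mul_eq (hI : I ≠ ⊥) {J : Ideal R} {f g : R} (hf : f ≠ 0)
    (hg : g ≠ 0) (hIJ : Ideal.span {f} * J = Ideal.span {g} * I) :
    IsBlowup π (affineBlowup.idealSheaf I) ↔ IsBlowup π (affineBlowup.idealSheaf J) := by
  have hJ : J ≠ ⊥ := by
    rintro rfl
    rw [Ideal.mul_bot] at hIJ
    rcases Ideal.mul_eq_bot.mp hIJ.symm with h | h
    · exact hg (Ideal.span_singleton_eq_bot.mp h)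
    · exact hI h
  rw [← isBlowup_span_singleton_mul_iff hI hg (π := π), ← hIJ,
    isBlowup_span_singleton_mul_iff hJ hf]

end Scaling

end Literature.AlgebraicGeometry.Resolution

end
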